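/-
Copyright (c) 2026. All rights reserved.
Released under Apache 2.0 license as described in the file LICENSE.
-/
import Literature.NumberTheory.Automorphic.QuaternionicSIdealClasses
import Mathlib.LinearAlgebra.Matrix.Permutation
import Mathlib.Algebra.DirectSum.LinearMap
import Mathlib.Data.Int.Order.Units
import HarnessLib

/-!
# The dimension of a sign space of the Brandt module: `2^{#T} · dim M^χ(O) = ∑_{g ∈ (ℤ/2ℤ)^T} χ(g) · #Fix(Φ_T g)`
# (Martin, J. Number Theory 188 (2018), Lemma 11 and Prop. 12, on the quaternion side; Martin 2018 §4.3)

[tag: quaternion_algebra] [tag: eichler_order] [tag: hecke_operator]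

Topic `NumberTheory/Automorphic`. Lane `lit-hodgefound`, seat p12, gen 52 — sequel of
`BrandtModuleSignPatternDecomposition.lean` (`ℚ^{Cls O} = ⊕_χ M^χ(O)`) and `QuaternionicSIdealClasses.lean` (the sign group
`Φ_T : (ℤ/2ℤ)^T → Sym(Cls O)`, Burnside `∑_g #Fix(Φ_T g) = 2^{#T} h_T`).

Martin [Martin2018RefinedDimensions, §3] proves, for a squarefree `M ∣ N` and a sign pattern `ε_M` (a multiplicative
function `d ↦ ε_M(d)` on the divisors of `M` with `ε_M(p) ∈ {±1}`):

* LEMMA 11: `∑_{d ∣ M} ε(d) ε'(d) = 2^{ω(M)}` if `ε = ε'` and `0` else;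
* PROPOSITION 12: `dim S_k^{new, ε_M}(N) = 2^{−ω(M)} ∑_{d ∣ M} ε_M(d) tr_{S_k^{new}(N)} W_d` ("each term on the right gives a
  contribution of `± dim S_k^{new, ε'_M}(N)`. The sign in the contribution is precisely `ε_M(d) ε'_M(d)`. Hence by the above
  lemma, the sum appearing on the right is just `2^{ω(M)} dim S_k^{new, ε_M}(N)`").

The same argument on the quaternion side — the Brandt module `ℚ^{Cls O}` of an Eichler order (every `S : XiSetup N⁺ N⁻`)
with the commuting involutions `Φ_T(g)`, `g ∈ (ℤ/2ℤ)^T`, whose traces are numbers of fixed classes — gives, for every finite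
`T` and every sign pattern `χ : T → {±1}`:

* §1 `signCharacter T χ : (ℤ/2ℤ)^T →* {±1}`, `χ(g) = ∏_r χ_r^{g_r}` (the multiplicative function `d ↦ ε(d)`):
  `signCharacter_mulSingle`, `signCharacter_one`, `signCharacter_injective`, and **`sum_signCharacter_mul_signCharacter`**
  (LEMMA 11: `∑_g χ(g) χ'(g) = 2^{#T} [χ = χ']`), `sum_signCharacter` (`∑_g χ(g) = 2^{#T} [χ = 1]`);
* §2 **`apply_atkinLehnerHom_of_mem_signSpace`** (`φ(Φ_T(g) c) = χ(g) φ(c)` for `φ ∈ M^χ(O)`),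
  `funLeft_atkinLehnerHom_mem_signSpace`, `restrict_funLeft_atkinLehnerHom_signSpace` (`Φ_T(g)|_{M^χ} = χ(g) · id`);
* §3 **`trace_funLeft_atkinLehnerHom`** (`tr Φ_T(g) = #Fix(Φ_T g)`), `trace_restrict_funLeft_atkinLehnerHom_signSpace`
  (`= χ(g) dim M^χ`), ★ **`natCard_fixedPoints_atkinLehnerHom_eq_sum`** (`#Fix(Φ_T g) = ∑_{χ} χ(g) dim M^χ(O)` — "each
  term gives a contribution `± dim`");
* §4 ★★★ **`two_pow_mul_finrank_signSpace_eq_sum`** (PROPOSITION 12 on the quaternion side: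
  `2^{#T} dim M^χ(O) = ∑_{g} χ(g) #Fix(Φ_T g)`), and consequences: **`finrank_signSpace_le_finrank_signSpace_one`**
  (`dim M^χ(O) ≤ dim M^{+_T}(O) = h_T`, the quaternionic form of [Martin2018, §1]: "`dim S_2^{new, ε}(N) ≤
  dim S_2^{new, −_N}(N)`" for every `ε`), `finrank_signSpace_le_natCard_sClassSet`, `two_mul_finrank_signSpace_singleton`
  (`T = {r}`: `2 dim M^{±} = h ± #Fix(W_r)`, [Martin2018, §4.3 (4.4)]: `dim M_0^{χ_𝔭}(O) = h − s_𝔭` resp. `s_𝔭`).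

## References

* [Martin2018RefinedDimensions] K. Martin, *Refined dimensions of cusp forms, and equidistribution and bias of signs*,
  J. Number Theory 188 (2018) 1–17 (held: arXiv 1609.05386), §3: sign patterns, Lemma 11, Proposition 12.
* [Martin2018] K. Martin, *Congruences for modular forms mod 2 and quaternionic `S`-ideal classes*, Canad. J. Math. 70
  (2018) (held: arXiv 1701.07864): §1 (`dim S_2^{new,ε}(N) ≤ dim S_2^{new,−_N}(N)`), §3.3 (`S_k^χ(O) ≃ S_{k+2}^{new,−χ}(𝔑)`),
  §4.3 (4.4) (`dim M_0^{χ_𝔭}(O) = h − s_𝔭`, `s_𝔭`).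
* [Voight2021] J. Voight, *Quaternion Algebras*, GTM 288 (2021): (41.3.5), Cor. 41.4.10.

## Scope (honest)

Martin's Prop. 12 is about `S_k^{new}(N)` and the Atkin–Lehner operators `W_d`; here the identical trace argument is run on
the quaternionic side (weight `0`, `F = ℚ`, Eichler level `N⁺`, the family `W_r` of `BrandtModuleSignPatternDecomposition`);
the Jacquet–Langlands transfer `S_0^χ(O) ≃ S_2^{new, −χ}(𝔑)` of [Martin2018, §3.3] is NOT formalised. One definition
(`signCharacter`), theorems otherwise; no named fact, no instance.
-/

noncomputable section

open scoped Pointwise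

namespace Literature.NumberTheory.Automorphic

namespace Brandt

/-! ## §1 The character `χ(g) = ∏_r χ_r^{g_r}` of a sign pattern and its orthogonality relations (Martin's Lemma 11) -/

section Character

variable (T : Finset ℕ)

/-- The two elements of `ℤ/2ℤ` (multiplicative notation). [folklore] -/
private theorem eq_one_or_eq_ofAdd_one'' (z : Multiplicative (ZMod 2)) : z = 1 ∨ z = Multiplicative.ofAdd 1 := by
  revert z; decide

/-- `1 + 1 = 0` in `ℤ/2ℤ`, multiplicatively. [folklore] -/
private theorem ofAdd_one_mul_ofAdd_one : Multiplicative.ofAdd (1 : ZMod 2) * Multiplicative.ofAdd 1 = 1 := by decide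

/-- `ofAdd 1 ≠ 1` in `ℤ/2ℤ`. [folklore] -/
private theorem ofAdd_one_ne_one : Multiplicative.ofAdd (1 : ZMod 2) ≠ 1 := by decide

/-- **Martin's multiplicative sign function `d ↦ ε(d)` of a sign pattern**, as a character of the sign group `(ℤ/2ℤ)^T`:
`χ(g) = ∏_{r ∈ T : g_r ≠ 0} χ_r ∈ {±1}` ("a multiplicative function `d ↦ ε_M(d)` on the divisors `d` of `M` such that
`ε_M(1) = 1` and `ε_M(p) ∈ {±1}` for each `p ∣ M`"; divisors `d ∣ M` ↔ subsets of the primes ↔ `g ∈ (ℤ/2ℤ)^T`).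
[cite: Martin2018RefinedDimensions, §3 (sign patterns)] -/
def signCharacter (χ : T → ℤˣ) : (T → Multiplicative (ZMod 2)) →* ℤˣ where
  toFun g := ∏ r, if g r = 1 then 1 else χ r
  map_one' := by simp
  map_mul' g h := by
    rw [← Finset.prod_mul_distrib]
    refine Finset.prod_congr rfl fun r _ => ?_
    rw [Pi.mul_apply]
    rcases eq_one_or_eq_ofAdd_one'' (g r) with hg | hg <;> rcases eq_one_or_eq_ofAdd_one'' (h r) with hh | hh
    · rw [hg, hh, one_mul, if_pos rfl, one_mul]
    · rw [hg, hh, one_mul, if_pos rfl, one_mul]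
    · rw [hg, hh, mul_one, if_pos rfl, mul_one]
    · rw [hg, hh, ofAdd_one_mul_ofAdd_one, if_pos rfl, if_neg ofAdd_one_ne_one, Int.units_mul_self]

/-- Unfolding `χ(g)`. [cite: Martin2018RefinedDimensions, §3] -/
theorem signCharacter_apply (χ : T → ℤˣ) (g : T → Multiplicative (ZMod 2)) :
    signCharacter T χ g = ∏ r, if g r = 1 then 1 else χ r :=
  rfl

/-- `χ(e_r^z) = χ_r^z`. [cite: Martin2018RefinedDimensions, §3 (`ε_M(p) ∈ {±1}`)] -/
theorem signCharacter_mulSingle (χ : T → ℤˣ) (r : T) (z : Multiplicative (ZMod 2)) :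
    signCharacter T χ (Pi.mulSingle r z) = if z = 1 then 1 else χ r := by
  classical
  rw [signCharacter_apply, Finset.prod_eq_single r]
  · rw [Pi.mulSingle_eq_same]
  · intro r' _ hr'
    rw [Pi.mulSingle_eq_of_ne hr', if_pos rfl]
  · intro h; exact absurd (Finset.mem_univ r) h

/-- **`χ(e_r) = χ_r`**: the character recovers the sign pattern. [cite: Martin2018RefinedDimensions, §3] -/
theorem signCharacter_mulSingle_ofAdd_one (χ : T → ℤˣ) (r : T) :
    signCharacter T χ (Pi.mulSingle r (Multiplicative.ofAdd 1)) = χ r := by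
  rw [signCharacter_mulSingle, if_neg (ofAdd_one_ne_one)]

/-- The trivial pattern `+_T` has trivial character (`ε_M(d) = 1` for all `d`). [cite: Martin2018RefinedDimensions, §3] -/
theorem signCharacter_one (g : T → Multiplicative (ZMod 2)) : signCharacter T 1 g = 1 := by
  rw [signCharacter_apply]
  exact Finset.prod_eq_one fun r _ => by rw [Pi.one_apply, ite_self]

/-- `χ(g)² = 1`. [cite: Martin2018RefinedDimensions, §3] -/
theorem signCharacter_mul_self (χ : T → ℤˣ) (g : T → Multiplicative (ZMod 2)) :
    signCharacter T χ g * signCharacter T χ g = 1 :=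
  Int.units_mul_self _

/-- `χ(g) ∈ {±1}` as a rational number. [cite: Martin2018RefinedDimensions, §3] -/
theorem signCharacter_cast_eq (χ : T → ℤˣ) (g : T → Multiplicative (ZMod 2)) :
    ((signCharacter T χ g : ℤ) : ℚ) = 1 ∨ ((signCharacter T χ g : ℤ) : ℚ) = -1 := by
  rcases Int.units_eq_one_or (signCharacter T χ g) with h | h
  · exact Or.inl (by rw [h]; norm_num)
  · exact Or.inr (by rw [h]; norm_num)

/-- `(χ χ')(g) = χ(g) χ'(g)` (pointwise product of patterns). [cite: Martin2018RefinedDimensions, §3 (proof of Lemma 11)] -/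
theorem signCharacter_mul (χ χ' : T → ℤˣ) (g : T → Multiplicative (ZMod 2)) :
    signCharacter T (χ * χ') g = signCharacter T χ g * signCharacter T χ' g := by
  rw [signCharacter_apply, signCharacter_apply, signCharacter_apply, ← Finset.prod_mul_distrib]
  refine Finset.prod_congr rfl fun r _ => ?_
  by_cases h : g r = 1
  · rw [if_pos h, if_pos h, if_pos h, one_mul]
  · rw [if_neg h, if_neg h, if_neg h, Pi.mul_apply]

/-- **Distinct sign patterns have distinct characters.** [cite: Martin2018RefinedDimensions, §3] -/
theorem signCharacter_injective : Function.Injective (signCharacter T) := by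
  intro χ χ' h
  funext r
  rw [← signCharacter_mulSingle_ofAdd_one T χ r, ← signCharacter_mulSingle_ofAdd_one T χ' r, h]

/-- A nontrivial pattern has a nontrivial value on some basis vector. [cite: Martin2018RefinedDimensions, §3 (proof of Lemma 11: `S ≠ ∅`)] -/
theorem exists_signCharacter_mulSingle_eq_neg_one {χ : T → ℤˣ} (h : χ ≠ 1) :
    ∃ r : T, signCharacter T χ (Pi.mulSingle r (Multiplicative.ofAdd 1)) = -1 := by
  obtain ⟨r, hr⟩ : ∃ r, χ r ≠ 1 := by
    by_contra hall
    push Not at hall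
    exact h (funext hall)
  refine ⟨r, ?_⟩
  rw [signCharacter_mulSingle_ofAdd_one]
  exact (Int.units_eq_one_or (χ r)).resolve_left hr

/-- **`∑_g χ(g) = 0` for a nontrivial pattern** (translating by `e_r` with `χ_r = −1` negates the sum). [cite: Martin2018RefinedDimensions, §3 Lemma 11 (proof)] -/
theorem sum_signCharacter_eq_zero {χ : T → ℤˣ} (h : χ ≠ 1) :
    ∑ g : T → Multiplicative (ZMod 2), ((signCharacter T χ g : ℤ) : ℚ) = 0 := by
  classical
  obtain ⟨r, hr⟩ := exists_signCharacter_mulSingle_eq_neg_one T h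
  set e := Pi.mulSingle (M := fun _ : T => Multiplicative (ZMod 2)) r (Multiplicative.ofAdd 1) with he
  have key : ∑ g : T → Multiplicative (ZMod 2), ((signCharacter T χ g : ℤ) : ℚ) =
      ∑ g : T → Multiplicative (ZMod 2), ((signCharacter T χ (g * e) : ℤ) : ℚ) :=
    (Fintype.sum_equiv (Equiv.mulRight e) _ _ fun _ => rfl).symm
  have hneg : ∀ g : T → Multiplicative (ZMod 2),
      ((signCharacter T χ (g * e) : ℤ) : ℚ) = -((signCharacter T χ g : ℤ) : ℚ) := fun g => by
    rw [map_mul, hr, Units.val_mul, Units.val_neg, Units.val_one, Int.cast_mul, Int.cast_neg, Int.cast_one]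
    ring
  simp only [hneg, Finset.sum_neg_distrib] at key
  linarith

/-- `∑_g 1 = 2^{#T}` (the order of the sign group). [cite: Martin2018RefinedDimensions, §3 Lemma 11] -/
theorem sum_signCharacter_one :
    ∑ g : T → Multiplicative (ZMod 2), ((signCharacter T 1 g : ℤ) : ℚ) = 2 ^ T.card := by
  simp only [signCharacter_one, Units.val_one, Int.cast_one, Finset.sum_const, Finset.card_univ, nsmul_eq_mul, mul_one]
  rw [Fintype.card_fun, Fintype.card_multiplicative, ZMod.card, Fintype.card_coe]
  push_cast
  ring

/-- **`∑_g χ(g) = 2^{#T}` if `χ = +_T` and `0` otherwise.** [cite: Martin2018RefinedDimensions, §3 Lemma 11] -/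
theorem sum_signCharacter [DecidableEq (T → ℤˣ)] (χ : T → ℤˣ) :
    ∑ g : T → Multiplicative (ZMod 2), ((signCharacter T χ g : ℤ) : ℚ) = if χ = 1 then (2 : ℚ) ^ T.card else 0 := by
  split_ifs with h
  · rw [h]; exact sum_signCharacter_one T
  · exact sum_signCharacter_eq_zero T h

/-- **MARTIN'S LEMMA 11 (orthogonality of sign patterns): `∑_g χ(g) χ'(g) = 2^{#T}` if `χ = χ'`, and `0` else.**
[cite: Martin2018RefinedDimensions, §3 Lemma 11] -/
theorem sum_signCharacter_mul_signCharacter [DecidableEq (T → ℤˣ)] (χ χ' : T → ℤˣ) :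
    ∑ g : T → Multiplicative (ZMod 2), ((signCharacter T χ g : ℤ) : ℚ) * ((signCharacter T χ' g : ℤ) : ℚ) =
      if χ = χ' then (2 : ℚ) ^ T.card else 0 := by
  have hprod : ∀ g, ((signCharacter T χ g : ℤ) : ℚ) * ((signCharacter T χ' g : ℤ) : ℚ) =
      ((signCharacter T (χ * χ') g : ℤ) : ℚ) := fun g => by
    rw [signCharacter_mul, Units.val_mul, Int.cast_mul]
  simp only [hprod]
  rw [sum_signCharacter]
  have hiff : χ * χ' = 1 ↔ χ = χ' := by
    constructor
    · intro h
      funext r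
      have hr := congrFun h r
      rw [Pi.mul_apply, Pi.one_apply] at hr
      calc χ r = χ r * (χ' r * χ' r) := by rw [Int.units_mul_self, mul_one]
        _ = χ' r := by rw [← mul_assoc, hr, one_mul]
    · rintro rfl
      funext r
      exact Int.units_mul_self _
  simp only [hiff]

end Character

/-! ## §2 The sign group on a sign space: `φ ∘ Φ_T(g) = χ(g) φ` -/

variable {Nplus Nminus : ℕ} (S : XiSetup Nplus Nminus) (T : Finset ℕ)

/-- **`φ(Φ_T(g) c) = χ(g) φ(c)` for `φ ∈ M^χ(O)`** and every `g ∈ (ℤ/2ℤ)^T` (iterate `φ(W_r c) = χ_r φ(c)`).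
[cite: Martin2018, §4.2 (4.3)] [cite: Martin2018RefinedDimensions, §3 (proof of Prop. 12)] -/
theorem XiSetup.apply_atkinLehnerHom_of_mem_signSpace {χ : T → ℤˣ} {v : ClassSet S.O → ℚ} (hv : v ∈ S.signSpace T χ)
    (g : T → Multiplicative (ZMod 2)) (c : ClassSet S.O) :
    v (S.atkinLehnerHom T g c) = ((signCharacter T χ g : ℤ) : ℚ) * v c := by
  classical
  rw [S.mem_signSpace_iff] at hv
  suffices key : ∀ (s : Finset T) (c : ClassSet S.O),
      v (S.atkinLehnerHom T (∏ i ∈ s, Pi.mulSingle i (g i)) c) =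
        ((signCharacter T χ (∏ i ∈ s, Pi.mulSingle i (g i)) : ℤ) : ℚ) * v c by
    have := key Finset.univ c
    rwa [Finset.univ_prod_mulSingle] at this
  intro s
  induction s using Finset.induction_on with
  | empty => intro c; rw [Finset.prod_empty, map_one, map_one, Equiv.Perm.coe_one, id_eq, Units.val_one, Int.cast_one, one_mul]
  | @insert j s hj ih =>
    intro c
    rw [Finset.prod_insert hj, map_mul, map_mul, Equiv.Perm.coe_mul, Function.comp_apply, Units.val_mul, Int.cast_mul]
    rcases eq_one_or_eq_ofAdd_one'' (g j) with h | h
    · rw [h, Pi.mulSingle_one, map_one, map_one, Equiv.Perm.coe_one, id_eq, Units.val_one, Int.cast_one, one_mul]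
      exact ih c
    · rw [h, S.atkinLehnerHom_mulSingle, signCharacter_mulSingle_ofAdd_one, hv j, ih c]
      ring

/-- **`φ ∘ Φ_T(g) = χ(g) φ ∈ M^χ(O)`**: the sign group preserves every sign space. [cite: Martin2018, §3.3 and §4.2] -/
theorem XiSetup.funLeft_atkinLehnerHom_eq_smul_of_mem_signSpace {χ : T → ℤˣ} {v : ClassSet S.O → ℚ}
    (hv : v ∈ S.signSpace T χ) (g : T → Multiplicative (ZMod 2)) :
    LinearMap.funLeft ℚ ℚ (S.atkinLehnerHom T g) v = ((signCharacter T χ g : ℤ) : ℚ) • v := by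
  funext c
  rw [LinearMap.funLeft_apply, Pi.smul_apply, smul_eq_mul]
  exact S.apply_atkinLehnerHom_of_mem_signSpace T hv g c

/-- `Φ_T(g)` maps `M^χ(O)` into itself. [cite: Martin2018, §3.3] -/
theorem XiSetup.mapsTo_funLeft_atkinLehnerHom_signSpace (χ : T → ℤˣ) (g : T → Multiplicative (ZMod 2)) :
    Set.MapsTo (LinearMap.funLeft ℚ ℚ (S.atkinLehnerHom T g)) (S.signSpace T χ) (S.signSpace T χ) := by
  intro v hv
  rw [SetLike.mem_coe, S.funLeft_atkinLehnerHom_eq_smul_of_mem_signSpace T hv g]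
  exact Submodule.smul_mem _ _ hv

/-- **`Φ_T(g)|_{M^χ(O)} = χ(g) · id`.** [cite: Martin2018RefinedDimensions, §3 (proof of Prop. 12: "a contribution of `± dim`")] -/
theorem XiSetup.restrict_funLeft_atkinLehnerHom_signSpace (χ : T → ℤˣ) (g : T → Multiplicative (ZMod 2)) :
    (LinearMap.funLeft ℚ ℚ (S.atkinLehnerHom T g)).restrict (S.mapsTo_funLeft_atkinLehnerHom_signSpace T χ g) =
      ((signCharacter T χ g : ℤ) : ℚ) • LinearMap.id := by
  ext v
  simp only [LinearMap.restrict_apply, LinearMap.smul_apply, LinearMap.id_apply, Submodule.coe_smul,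
    S.funLeft_atkinLehnerHom_eq_smul_of_mem_signSpace T v.2 g]

/-! ## §3 Traces: `tr Φ_T(g) = #Fix(Φ_T g) = ∑_χ χ(g) dim M^χ(O)` -/

section Trace

variable [Fintype (ClassSet S.O)] [DecidableEq (ClassSet S.O)]

/-- `(· ∘ Φ_T(g))` is `Matrix.toLin'` of the permutation matrix of `Φ_T(g)`. [folklore] -/
private theorem toLin_permMatrix_atkinLehnerHom (g : T → Multiplicative (ZMod 2)) :
    Matrix.toLin' ((S.atkinLehnerHom T g).permMatrix ℚ) = LinearMap.funLeft ℚ ℚ (S.atkinLehnerHom T g) := by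
  apply LinearMap.ext
  intro v
  rw [Matrix.toLin'_apply, Matrix.permMatrix_mulVec]
  rfl

/-- **`tr Φ_T(g) = #Fix(Φ_T g)`** on the Brandt module (a permutation operator). [cite: Martin2018RefinedDimensions, §1 (traces of Atkin–Lehner operators)] [cite: Voight2021, (41.3.5)] -/
theorem XiSetup.trace_funLeft_atkinLehnerHom (g : T → Multiplicative (ZMod 2)) :
    LinearMap.trace ℚ _ (LinearMap.funLeft ℚ ℚ (S.atkinLehnerHom T g)) =
      Nat.card {c : ClassSet S.O // S.atkinLehnerHom T g c = c} := by
  rw [← toLin_permMatrix_atkinLehnerHom S T g, Matrix.trace_toLin'_eq, Matrix.trace]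
  simp only [Matrix.diag_apply, PEquiv.toMatrix_apply, Equiv.toPEquiv_apply, Option.mem_def, Option.some.injEq]
  rw [Finset.sum_boole, Nat.card_eq_fintype_card, Fintype.card_subtype]

omit [Fintype (ClassSet S.O)] [DecidableEq (ClassSet S.O)] in
/-- `tr (Φ_T(g)|_{M^χ(O)}) = χ(g) dim M^χ(O)`. [cite: Martin2018RefinedDimensions, §3 (proof of Prop. 12)] -/
theorem XiSetup.trace_restrict_funLeft_atkinLehnerHom_signSpace (χ : T → ℤˣ) (g : T → Multiplicative (ZMod 2)) :
    LinearMap.trace ℚ _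
        ((LinearMap.funLeft ℚ ℚ (S.atkinLehnerHom T g)).restrict (S.mapsTo_funLeft_atkinLehnerHom_signSpace T χ g)) =
      ((signCharacter T χ g : ℤ) : ℚ) * Module.finrank ℚ (S.signSpace T χ) := by
  rw [S.restrict_funLeft_atkinLehnerHom_signSpace T χ g, map_smul, LinearMap.trace_id, smul_eq_mul]

/-- **`#Fix(Φ_T g) = ∑_χ χ(g) · dim M^χ(O)`** — the trace of `Φ_T(g)` computed block by block on `⊕_χ M^χ(O)` ("each term
on the right gives a contribution of `± dim`; the sign is `ε_M(d) ε'_M(d)`"). [cite: Martin2018RefinedDimensions, §3 (proof of Prop. 12)] -/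
theorem XiSetup.natCard_fixedPoints_atkinLehnerHom_eq_sum (g : T → Multiplicative (ZMod 2)) :
    (Nat.card {c : ClassSet S.O // S.atkinLehnerHom T g c = c} : ℚ) =
      ∑ χ : T → ℤˣ, ((signCharacter T χ g : ℤ) : ℚ) * Module.finrank ℚ (S.signSpace T χ) := by
  classical
  rw [← S.trace_funLeft_atkinLehnerHom T g,
    LinearMap.trace_eq_sum_trace_restrict (S.isInternal_signSpace T)
      (fun χ => S.mapsTo_funLeft_atkinLehnerHom_signSpace T χ g)]
  exact Finset.sum_congr rfl fun χ _ => S.trace_restrict_funLeft_atkinLehnerHom_signSpace T χ g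

end Trace

/-! ## §4 Martin's Proposition 12 on the quaternion side and its consequences -/

/-- **`2^{#T} · dim M^χ(O) = ∑_{g ∈ (ℤ/2ℤ)^T} χ(g) · #Fix(Φ_T g)`** for every Eichler order of a definite quaternion algebra
over `ℚ`, every finite `T` and every sign pattern `χ` — Martin's Proposition 12 (`dim S_k^{new, ε_M}(N) =
2^{−ω(M)} ∑_{d ∣ M} ε_M(d) tr W_d`) run on the Brandt module: expand `#Fix = tr` over the sign spaces and use the
orthogonality of Lemma 11. [cite: Martin2018RefinedDimensions, §3 Prop. 12 and Lemma 11] [cite: Martin2018, §3.3 and §4.3] -/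
theorem XiSetup.two_pow_mul_finrank_signSpace_eq_sum (χ : T → ℤˣ) :
    (2 : ℚ) ^ T.card * Module.finrank ℚ (S.signSpace T χ) =
      ∑ g : T → Multiplicative (ZMod 2),
        ((signCharacter T χ g : ℤ) : ℚ) * Nat.card {c : ClassSet S.O // S.atkinLehnerHom T g c = c} := by
  classical
  haveI : Fintype (ClassSet S.O) := Fintype.ofFinite _
  simp only [S.natCard_fixedPoints_atkinLehnerHom_eq_sum T, Finset.mul_sum]
  rw [Finset.sum_comm]
  simp only [← mul_assoc, ← Finset.sum_mul, sum_signCharacter_mul_signCharacter T χ, ite_mul, zero_mul]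
  rw [Finset.sum_ite_eq, if_pos (Finset.mem_univ χ)]

/-- The same identity with the natural-number cast arranged as `dim = 2^{−#T} ∑`. [cite: Martin2018RefinedDimensions, §3 Prop. 12] -/
theorem XiSetup.finrank_signSpace_eq_sum_div (χ : T → ℤˣ) :
    (Module.finrank ℚ (S.signSpace T χ) : ℚ) =
      (∑ g : T → Multiplicative (ZMod 2),
        ((signCharacter T χ g : ℤ) : ℚ) * Nat.card {c : ClassSet S.O // S.atkinLehnerHom T g c = c}) / 2 ^ T.card := by
  rw [← S.two_pow_mul_finrank_signSpace_eq_sum T χ, mul_div_cancel_left₀ _ (pow_ne_zero _ two_ne_zero)]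

/-- For the trivial pattern the formula is Burnside's count `2^{#T} h_T = ∑_g #Fix(Φ_T g)`. [cite: Martin2018RefinedDimensions, §3 Prop. 12] [cite: Martin2018, §3.3 (3.9)] -/
theorem XiSetup.two_pow_mul_finrank_signSpace_one_eq_sum :
    (2 : ℚ) ^ T.card * Module.finrank ℚ (S.signSpace T 1) =
      ∑ g : T → Multiplicative (ZMod 2), (Nat.card {c : ClassSet S.O // S.atkinLehnerHom T g c = c} : ℚ) := by
  rw [S.two_pow_mul_finrank_signSpace_eq_sum T 1]
  exact Finset.sum_congr rfl fun g _ => by rw [signCharacter_one, Units.val_one, Int.cast_one, one_mul]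

/-- **`dim M^χ(O) ≤ dim M^{+_T}(O)` for every sign pattern `χ`** (`χ(g) #Fix ≤ #Fix` termwise) — the quaternionic form of
"`dim S_2^{new, ε}(N) ≤ dim S_2^{new, −_N}(N)` for any sign pattern `ε`" (bias towards `−_N`, via
`S_0^χ(O) ≃ S_2^{new, −χ}(𝔑)`). [cite: Martin2018, §1 and §3.3] [cite: Martin2018RefinedDimensions, §3 Prop. 12] -/
theorem XiSetup.finrank_signSpace_le_finrank_signSpace_one (χ : T → ℤˣ) :
    Module.finrank ℚ (S.signSpace T χ) ≤ Module.finrank ℚ (S.signSpace T 1) := by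
  have h1 := S.two_pow_mul_finrank_signSpace_eq_sum T χ
  have h2 := S.two_pow_mul_finrank_signSpace_one_eq_sum T
  have hle : ∑ g : T → Multiplicative (ZMod 2),
      ((signCharacter T χ g : ℤ) : ℚ) * Nat.card {c : ClassSet S.O // S.atkinLehnerHom T g c = c} ≤
      ∑ g : T → Multiplicative (ZMod 2), (Nat.card {c : ClassSet S.O // S.atkinLehnerHom T g c = c} : ℚ) := by
    refine Finset.sum_le_sum fun g _ => ?_
    have hn : (0 : ℚ) ≤ Nat.card {c : ClassSet S.O // S.atkinLehnerHom T g c = c} := Nat.cast_nonneg _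
    rcases signCharacter_cast_eq T χ g with h | h <;> rw [h] <;> linarith
  have h2pos : (0 : ℚ) < 2 ^ T.card := pow_pos two_pos _
  have key : (2 : ℚ) ^ T.card * Module.finrank ℚ (S.signSpace T χ) ≤ 2 ^ T.card * Module.finrank ℚ (S.signSpace T 1) := by
    rw [h1, h2]; exact hle
  exact_mod_cast le_of_mul_le_mul_left key h2pos

/-- **`dim M^χ(O) ≤ h_T = #Cl_T(O)`** for every `χ`. [cite: Martin2018, §1, §3.3 (3.9) and §4.4 Prop. 7] -/
theorem XiSetup.finrank_signSpace_le_natCard_sClassSet (χ : T → ℤˣ) :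
    Module.finrank ℚ (S.signSpace T χ) ≤ Nat.card (S.SClassSet T) := by
  rw [← S.finrank_signSpace_one_eq_natCard_sClassSet T]
  exact S.finrank_signSpace_le_finrank_signSpace_one T χ

/-- `dim M^χ(O) ≤ #Typ O`-many? No: `dim M^χ(O) ≤ h`, the class number (trivially from the decomposition). [cite: Martin2018, §3.3] -/
theorem XiSetup.finrank_signSpace_le_natCard_classSet (χ : T → ℤˣ) :
    Module.finrank ℚ (S.signSpace T χ) ≤ Nat.card (ClassSet S.O) :=
  (S.finrank_signSpace_le_natCard_sClassSet T χ).trans (S.natCard_sClassSet_le_natCard_classSet T)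

/-- **One prime: `2 dim M^{χ}(O) = h + χ_r · #Fix(W_r)` for `T = {r}`** — Martin's (4.4): `dim M_0^{+_𝔭}(O) = h − s_𝔭`,
`dim M_0^{−_𝔭}(O) = s_𝔭` with `s_𝔭` the number of orbits of size `2` of `σ_𝔭` (`h − 2 s_𝔭 = #Fix(σ_𝔭)`).
[cite: Martin2018, §4.3 (4.4)] [cite: Martin2018RefinedDimensions, §2 (2.1) (`dim S^{new,±} = ½(dim ± tr W)`)] -/
theorem XiSetup.two_mul_finrank_signSpace_singleton (r : ℕ) (χ : ({r} : Finset ℕ) → ℤˣ) :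
    (2 : ℚ) * Module.finrank ℚ (S.signSpace {r} χ) =
      Nat.card (ClassSet S.O) +
        ((χ ⟨r, Finset.mem_singleton_self r⟩ : ℤ) : ℚ) * Nat.card {c : ClassSet S.O // S.atkinLehner r c = c} := by
  classical
  have h := S.two_pow_mul_finrank_signSpace_eq_sum {r} χ
  rw [Finset.card_singleton, pow_one] at h
  rw [h]
  -- the sign group of `{r}` has the two elements `1` and `e_r`
  set r₀ : ({r} : Finset ℕ) := ⟨r, Finset.mem_singleton_self r⟩ with hr₀
  have huniv : (Finset.univ : Finset (({r} : Finset ℕ) → Multiplicative (ZMod 2))) =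
      {1, Pi.mulSingle r₀ (Multiplicative.ofAdd 1)} := by
    apply Finset.eq_of_subset_of_card_le
    · intro g _
      rw [Finset.mem_insert, Finset.mem_singleton]
      rcases eq_one_or_eq_ofAdd_one'' (g r₀) with h1 | h1
      · left
        funext i
        have hi : i = r₀ := Subtype.ext (Finset.mem_singleton.mp i.2)
        rw [hi, h1, Pi.one_apply]
      · right
        funext i
        have hi : i = r₀ := Subtype.ext (Finset.mem_singleton.mp i.2)
        rw [hi, h1, Pi.mulSingle_eq_same]
    · rw [Finset.card_univ, Fintype.card_fun, Fintype.card_multiplicative, ZMod.card, Fintype.card_coe,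
        Finset.card_singleton, pow_one]
      exact Finset.card_le_two
  have hne : (1 : ({r} : Finset ℕ) → Multiplicative (ZMod 2)) ≠ Pi.mulSingle r₀ (Multiplicative.ofAdd 1) := by
    intro h1
    have := congrFun h1 r₀
    rw [Pi.one_apply, Pi.mulSingle_eq_same] at this
    exact absurd this (by decide)
  rw [huniv, Finset.sum_pair hne, map_one, map_one, Units.val_one, Int.cast_one, one_mul,
    signCharacter_mulSingle_ofAdd_one]
  have hfix1 : Nat.card {c : ClassSet S.O // (1 : Equiv.Perm (ClassSet S.O)) c = c} = Nat.card (ClassSet S.O) :=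
    Nat.card_congr (Equiv.subtypeUnivEquiv fun c => rfl)
  have hfix2 : Nat.card {c : ClassSet S.O // S.atkinLehnerHom {r} (Pi.mulSingle r₀ (Multiplicative.ofAdd 1)) c = c} =
      Nat.card {c : ClassSet S.O // S.atkinLehner r c = c} :=
    Nat.card_congr (Equiv.subtypeEquivRight fun c => by rw [S.atkinLehnerHom_mulSingle])
  rw [hfix1, hfix2]

/-- `2 dim M^{+}(O) = h + #Fix(W_r)` and `2 dim M^{−}(O) = h − #Fix(W_r)` for one condition at `r` — the dimension count of
`BrandtMatrixRamifiedEigenspaces` / `BrandtModuleLevelInvolutionEigenspaces` recovered. [cite: Martin2018, §4.3 (4.4)] [cite: Voight2021, (41.3.5)] -/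
theorem XiSetup.two_mul_finrank_signSpace_singleton_one_and_neg_one (r : ℕ) :
    (2 : ℚ) * Module.finrank ℚ (S.signSpace {r} 1) =
        Nat.card (ClassSet S.O) + Nat.card {c : ClassSet S.O // S.atkinLehner r c = c} ∧
      (2 : ℚ) * Module.finrank ℚ (S.signSpace {r} (-1)) =
        Nat.card (ClassSet S.O) - Nat.card {c : ClassSet S.O // S.atkinLehner r c = c} := by
  constructor
  · rw [S.two_mul_finrank_signSpace_singleton r 1, Pi.one_apply, Units.val_one, Int.cast_one, one_mul]
  · rw [S.two_mul_finrank_signSpace_singleton r (-1), Pi.neg_apply, Pi.one_apply, Units.val_neg, Units.val_one,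
      Int.cast_neg, Int.cast_one, neg_one_mul, sub_eq_add_neg]

end Brandt

end Literature.NumberTheory.Automorphic
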